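import Mathlib
import Summits.KontsevichZagierPeriods.Zeta5Search.BrickWeightLocality

/-!
# BrickPhiAllPrimes — the Frobenius factor `Φ_{n,p}` of the brick kernels at EVERY prime, `p = 2` included: the
sign-complete `N/D` representation, reflection for even `A`, `p`-integrality with slope of the Taylor coefficients `φ_m`,
the unit `φ_0`, and digit-locality `v_p(Φ(−j′) − Φ(−j)) ≥ e + 1` (cell `pub-zeta5`, seat ct-1 g42)

HONEST FRAMING: systematic search; no irrationality claim unless certified.  INSTRUMENT lemmas about the rational function
`Φ_{n,p}(t) = W^{A−2B}∏_{p∤ℓ≤np}(pt−ℓ)^B∏(pt+np+ℓ)^B/∏(pt+ℓ)^A` (`BrickKernelFrobenius.brickPhi`, the Frobenius factor of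
`p^A·R_{np}(pt) = p^ε·Φ_{n,p}(t)·R_n(t)`) and its Taylor coefficients `φ_m = [T^m]Φ_{n,p}(−K+T)` (`BrickLaurent.phiCoeff`).
Nothing here concerns `ζ(5)`/`ζ(3)`; no `γ`/denominator-law/record statement; records in print UNMOVED; NOTHING IS
DISCHARGED (net named-fact debt 0).

WHY (ct-1 g39–g41): `Zudilin2002.integrality` is reduced in the tree to `BrickPropositionHInf.propositionH_inf` WITHOUT its
hypothesis `p ≠ 2`, at `(A,B,ε) = (6,1,0)`, for the weight `n − 2k` (`Zudilin2002IntegralityCentreFree.integrality_of_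
propositionH_two`).  The zeta5-irr chain assumes `p ≠ 2` from its first use of `Φ`: `BrickPhiTaylor.brickPhi_neg_add_eq`
absorbs the sign `∏_{p∤ℓ≤np}(−1) = (−1)^{n(p−1)} = +1` (odd `p`), and the arithmetic of `φ_m` (`BrickPhiCoeff`,
`BrickWeightLocality`: `Φ(−K+T) = 1 + p³G`, locality `e + 3`) needs `p ≥ 5`.  This file gives the `p`-UNIFORM versions
(weaker where they must be, exact in the sign) — the Taylor data a level induction at the prime `2` would consume:

* `prod_filter_neg_one_eq_pow` — `∏_{p∤ℓ≤np}(−1) = (−1)^{n(p−1)}` (every `p > 0`);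
* **`brickPhi_neg_add_eq_sign`** — `Φ_{n,p}(−j+t) = (−1)^{n(p−1)B}·N(t)/D(t)` for EVERY prime (`N = phiNum`, `D = phiDen` of
  `BrickPhiTaylor`, unchanged); at `p = 2` the sign is `(−1)^{nB}` (`brickPhi_two_neg_add_eq`); `phiCoeff_zero_eq_sign`
  (`φ_0 = (−1)^{n(p−1)B}·Φ_{n,p}(−K)`);
* **`brickPhi_reflect_of_even`** — `Φ_{n,p}(−n−t) = Φ_{n,p}(t)` for every `p > 0` once `A` is EVEN (the tree's
  `BrickPhiSymmetry.brickPhi_reflect`: `p` odd, any `A`); `brickPhi_neg_sub_natCast_of_even`;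
* `not_dvd_phiDen_coeff_zero'`, `not_dvd_phiNum_coeff_zero` — `D(0)`, `N(0)` prime to `p` (every prime; each factor is
  `≡ ±ℓ`, `p ∤ ℓ`); hence **`padicValuation_phiCoeff_zero_eq_one`** (`φ_0` a `p`-adic unit) and
  **`padicValuation_brickPhi_neg_eq_one'`** (`v_p(Φ_{n,p}(−j)) = 0`, every prime, every `A, B` — the tree's version carries
  `p ≥ 5`, `2B ≤ A` from its `Φ4` route);
* **`isSlopeInt_phiSeries_neg_one`** — `φ_m ∈ p^mℤ_(p)` for every `m`, EVERY prime (`N(T), D(T)` are products of factors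
  `c ± pT`, `D(0)` a unit): `padicValuation_phiCoeff_le_exp_neg`, `padicValuation_phiCoeff_le_one`;
* **`padicValuation_brickPhi_sub_le_succ`** — `v_p(Φ_{n,p}(−j′) − Φ_{n,p}(−j)) ≤ exp(−(e+1))` whenever `p^e ∣ j − j′`, EVERY
  prime (the tree: `exp(−(e+3))`, `p ≥ 5`); at `p = 2`: consecutive-digit locality with one spare factor `2`.

Theorems only (0 `def`); tree vocabulary (`brickPhi`, `phiNum`, `phiDen`, `phiSeries`, `phiCoeff`, `ScaledSeries.IsSlopeInt`);
nothing restated.  DATA (seat desk, exact, NOT used by the kernel): for `(A,B,ε) = (6,1,0)` the `p = 2` analogue of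
`propositionH_inf`'s conclusion holds for every `M ≤ 128` and every tested admissible weight that is genuinely antisymmetric
(margins ≥ 1); the verbatim `p = 2` statement fails only for the symmetric weights `2^{ℓ−1}`, `2^{ℓ−1}(−1)^k` on the
harmonic cell at `M = 2^ℓ`, and only for `(A,B) ∈ {(2,1),(4,2),(6,2)}` among ten kernels tested (margin −1).
-/

namespace Summit.KontsevichZagierPeriods.Zeta5Search.BrickPhiAllPrimes

open Finset Nat Polynomial WithZero
open Summit.KontsevichZagierPeriods.Zeta5Search.FrobeniusFactorisation (prod_filter_not_dvd_eq_prod_prod)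
open Summit.KontsevichZagierPeriods.Zeta5Search.BrickKernelFrobenius (brickPhi)
open Summit.KontsevichZagierPeriods.Zeta5Search.BrickPhiTaylor (phiNum phiDen)
open Summit.KontsevichZagierPeriods.Zeta5Search.BrickPhiSymmetry (prod_filter_reflect)
open Summit.KontsevichZagierPeriods.Zeta5Search.BrickLaurent (expandAt phiSeries phiCoeff coeff_zero_expandAt aeval_eq_eval_map
  eval_phiDen_zero_ne_zero)
open Summit.KontsevichZagierPeriods.Zeta5Search.ScaledSeries (IsSlopeInt isSlopeInt_mul isSlopeInt_C isSlopeInt_one isSlopeInt_pow)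
open Summit.KontsevichZagierPeriods.Zeta5Search.BrickPhiCoeff (isSlopeInt_coe_map_int isSlopeInt_inv)
open Summit.KontsevichZagierPeriods.Zeta5Search.BrickWeightLocality (eval_phiDen_shift)

noncomputable section

/-! ## The sign `∏_{p∤ℓ≤np}(−1)` and the `N/D` representation at every prime -/

section sign

variable {p : ℕ}

/-- `∏_{1≤ℓ≤np, p∤ℓ}(−1) = (−1)^{n(p−1)}` for every `p > 0` (blocks of `p − 1` elements); `= (−1)^n` at `p = 2`. [folklore] -/
theorem prod_filter_neg_one_eq_pow {R : Type*} [CommRing R] (hp : 0 < p) (n : ℕ) :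
    ∏ _m ∈ (Icc 1 (n * p)).filter (fun m => ¬ p ∣ m), (-1 : R) = (-1) ^ (n * (p - 1)) := by
  rw [prod_filter_not_dvd_eq_prod_prod hp n (fun _ => (-1 : R))]
  simp only [Finset.prod_const, Nat.card_Icc, Finset.card_range]
  rw [← pow_mul, show p - 1 + 1 - 1 = p - 1 by omega, mul_comm]

/-- **`Φ_{n,p}(−j+t) = (−1)^{n(p−1)B}·N(t)/D(t)` for EVERY prime `p`** and every `t ∈ ℚ` (poles included: both sides are
`x/0 = 0` there), with the tree's `N = phiNum A B p n j`, `D = phiDen A p n j ∈ ℤ[T]`.  For odd `p` the sign is `+1`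
(`BrickPhiTaylor.brickPhi_neg_add_eq`); for `p = 2` it is `(−1)^{nB}`. -/
theorem brickPhi_neg_add_eq_sign (hp : p.Prime) (A B n : ℕ) (j : ℤ) (t : ℚ) :
    brickPhi A B p n (-(j : ℚ) + t) =
      (-1) ^ (n * (p - 1) * B) * (aeval t (phiNum A B p n j) / aeval t (phiDen A p n j)) := by
  have e1 : ∏ m ∈ (Icc 1 (n * p)).filter (fun m => ¬ p ∣ m), ((p : ℚ) * (-(j : ℚ) + t) - (m : ℚ)) =
      (-1) ^ (n * (p - 1)) *
        aeval t (∏ m ∈ (Icc 1 (n * p)).filter (fun m => ¬ p ∣ m), (C (j * p + (m : ℤ)) - C (p : ℤ) * X)) := by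
    rw [map_prod, ← prod_filter_neg_one_eq_pow (R := ℚ) hp.pos n, ← Finset.prod_mul_distrib]
    refine Finset.prod_congr rfl fun m _ => ?_
    simp only [map_sub, map_mul, aeval_C, aeval_X, algebraMap_int_eq, Int.coe_castRingHom]
    push_cast; ring
  have e2 : ∏ m ∈ (Icc 1 (n * p)).filter (fun m => ¬ p ∣ m), ((p : ℚ) * (-(j : ℚ) + t) + ((n * p : ℕ) : ℚ) + (m : ℚ))
      = aeval t (∏ m ∈ (Icc 1 (n * p)).filter (fun m => ¬ p ∣ m), (C (((n : ℤ) - j) * p + (m : ℤ)) + C (p : ℤ) * X)) := by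
    rw [map_prod]
    refine Finset.prod_congr rfl fun m _ => ?_
    simp only [map_add, map_sub, map_mul, aeval_C, aeval_X, algebraMap_int_eq, Int.coe_castRingHom]
    push_cast; ring
  have e3 : ∏ m ∈ (Icc 1 (n * p)).filter (fun m => ¬ p ∣ m), ((p : ℚ) * (-(j : ℚ) + t) + (m : ℚ))
      = aeval t (∏ m ∈ (Icc 1 (n * p)).filter (fun m => ¬ p ∣ m), (C ((m : ℤ) - j * p) + C (p : ℤ) * X)) := by
    rw [map_prod]
    refine Finset.prod_congr rfl fun m _ => ?_
    simp only [map_add, map_sub, map_mul, aeval_C, aeval_X, algebraMap_int_eq, Int.coe_castRingHom]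
    push_cast; ring
  have eW : (((∏ m ∈ (Icc 1 (n * p)).filter (fun m => ¬ p ∣ m), m : ℕ)) : ℚ) =
      aeval t (C (((∏ m ∈ (Icc 1 (n * p)).filter (fun m => ¬ p ∣ m), m : ℕ) : ℤ))) := by
    rw [aeval_C, algebraMap_int_eq]; simp
  rw [brickPhi, e1, e2, e3, eW, phiNum, phiDen]
  simp only [map_mul, map_pow]
  rw [mul_pow, pow_mul]
  ring

/-- `p = 2`: **`Φ_{n,2}(−j+t) = (−1)^{nB}·N(t)/D(t)`**. -/
theorem brickPhi_two_neg_add_eq (A B n : ℕ) (j : ℤ) (t : ℚ) :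
    brickPhi A B 2 n (-(j : ℚ) + t) = (-1) ^ (n * B) * (aeval t (phiNum A B 2 n j) / aeval t (phiDen A 2 n j)) := by
  simpa using brickPhi_neg_add_eq_sign Nat.prime_two A B n j t

/-- **Reflection at every prime for even `A`**: `Φ_{n,p}(−n − t) = Φ_{n,p}(t)` (`p > 0`, `A` even, every `B`, `n`, `t`):
each of the three products picks up `(−1)^{n(p−1)}` (`ℓ ↦ np − ℓ` on the denominator), cancelling as `(−1)^{n(p−1)(2B−A)}`
(the tree's `BrickPhiSymmetry.brickPhi_reflect` takes `p` odd instead). -/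
theorem brickPhi_reflect_of_even {K : Type*} [Field K] (hp : 0 < p) {A : ℕ} (hA : Even A) (B n : ℕ) (t : K) :
    brickPhi A B p n (-(n : K) - t) = brickPhi A B p n t := by
  obtain ⟨a, rfl⟩ := hA
  set σ : K := (-1) ^ (n * (p - 1)) with hσ
  have hsign := prod_filter_neg_one_eq_pow (R := K) hp n
  have hσ2 : σ * σ = 1 := by rw [hσ, ← pow_add, ← two_mul, pow_mul, neg_one_sq, one_pow]
  have e1 : ∏ m ∈ (Icc 1 (n * p)).filter (fun m => ¬ p ∣ m), ((p : K) * (-(n : K) - t) - m) =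
      σ * ∏ m ∈ (Icc 1 (n * p)).filter (fun m => ¬ p ∣ m), ((p : K) * t + (n * p : ℕ) + m) := by
    rw [hσ, ← hsign, ← Finset.prod_mul_distrib]
    exact Finset.prod_congr rfl fun m _ => by push_cast; ring
  have e2 : ∏ m ∈ (Icc 1 (n * p)).filter (fun m => ¬ p ∣ m), ((p : K) * (-(n : K) - t) + (n * p : ℕ) + m) =
      σ * ∏ m ∈ (Icc 1 (n * p)).filter (fun m => ¬ p ∣ m), ((p : K) * t - m) := by
    rw [hσ, ← hsign, ← Finset.prod_mul_distrib]
    exact Finset.prod_congr rfl fun m _ => by push_cast; ring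
  have e3 : ∏ m ∈ (Icc 1 (n * p)).filter (fun m => ¬ p ∣ m), ((p : K) * (-(n : K) - t) + m) =
      σ * ∏ m ∈ (Icc 1 (n * p)).filter (fun m => ¬ p ∣ m), ((p : K) * t + m) := by
    rw [← prod_filter_reflect p n (fun m => (p : K) * t + (m : K)), hσ, ← hsign, ← Finset.prod_mul_distrib]
    refine Finset.prod_congr rfl fun m hm => ?_
    rw [mem_filter, mem_Icc] at hm
    rw [Nat.cast_sub hm.1.2]
    push_cast
    ring
  have key : ∀ W X Y Z : K, W * (σ * X) ^ B * (σ * Y) ^ B / (σ * Z) ^ (a + a) = W * Y ^ B * X ^ B / Z ^ (a + a) := by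
    intro W X Y Z
    rw [mul_pow σ Z, pow_add σ, ← mul_pow, hσ2, one_pow, one_mul,
      show W * (σ * X) ^ B * (σ * Y) ^ B = (σ * σ) ^ B * (W * Y ^ B * X ^ B) by ring, hσ2, one_pow, one_mul]
  unfold brickPhi
  rw [e1, e2, e3]
  exact key _ _ _ _

/-- In particular **`Φ_{n,p}(−(n−j)) = Φ_{n,p}(−j)`** for `j ≤ n`, every `p > 0`, `A` even. -/
theorem brickPhi_neg_sub_natCast_of_even {K : Type*} [Field K] (hp : 0 < p) {A : ℕ} (hA : Even A) (B : ℕ) {n j : ℕ}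
    (hj : j ≤ n) : brickPhi A B p n (-((n - j : ℕ) : K)) = brickPhi A B p n (-(j : K)) := by
  rw [← brickPhi_reflect_of_even hp hA B n (-(j : K)), Nat.cast_sub hj]
  ring_nf

/-- The constant term `D(0) = (∏_{p∤ℓ≤np}(ℓ − jp))^A` of the denominator is prime to `p` — EVERY prime (each factor is
`≡ ℓ (mod p)`, `p ∤ ℓ`; the tree's `BrickPhiTaylor.not_dvd_phiDen_coeff_zero` goes through the block law and needs `p ≥ 5`). -/
theorem not_dvd_phiDen_coeff_zero' (hp : p.Prime) (A n : ℕ) (j : ℤ) : ¬ (p : ℤ) ∣ (phiDen A p n j).coeff 0 := by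
  have hprime : Prime (p : ℤ) := Nat.prime_iff_prime_int.1 hp
  rw [phiDen, coeff_zero_eq_eval_zero, eval_pow, eval_prod]
  simp only [eval_add, eval_mul, eval_C, eval_X, mul_zero, add_zero]
  intro h
  obtain ⟨m, hm, hdm⟩ := (hprime.dvd_finsetProd_iff _).1 (hprime.dvd_of_dvd_pow h)
  refine (mem_filter.1 hm).2 (Int.natCast_dvd_natCast.1 ?_)
  simpa using dvd_add hdm (dvd_mul_left (p : ℤ) j)

/-- The constant term `N(0) = W^{A−2B}·∏(jp+ℓ)^B·∏((n−j)p+ℓ)^B` of the numerator is prime to `p` — EVERY prime. -/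
theorem not_dvd_phiNum_coeff_zero (hp : p.Prime) (A B n : ℕ) (j : ℤ) : ¬ (p : ℤ) ∣ (phiNum A B p n j).coeff 0 := by
  have hprime : Prime (p : ℤ) := Nat.prime_iff_prime_int.1 hp
  have hS : ∀ m ∈ (Icc 1 (n * p)).filter (fun m => ¬ p ∣ m), ¬ (p : ℤ) ∣ (m : ℤ) := fun m hm h =>
    (mem_filter.1 hm).2 (Int.natCast_dvd_natCast.1 h)
  rw [phiNum, coeff_zero_eq_eval_zero]
  simp only [eval_mul, eval_pow, eval_prod, eval_add, eval_sub, eval_C, eval_X, mul_zero, sub_zero, add_zero]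
  intro h
  rcases hprime.dvd_or_dvd h with h | h
  · rcases hprime.dvd_or_dvd h with h | h
    · have h' := Int.natCast_dvd_natCast.1 (hprime.dvd_of_dvd_pow h)
      obtain ⟨m, hm, hdm⟩ := (hp.prime.dvd_finsetProd_iff _).1 h'
      exact (mem_filter.1 hm).2 hdm
    · obtain ⟨m, hm, hdm⟩ := (hprime.dvd_finsetProd_iff _).1 (hprime.dvd_of_dvd_pow h)
      exact hS m hm (by simpa using dvd_sub hdm (dvd_mul_left (p : ℤ) j))
  · obtain ⟨m, hm, hdm⟩ := (hprime.dvd_finsetProd_iff _).1 (hprime.dvd_of_dvd_pow h)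
    exact hS m hm (by simpa using dvd_sub hdm (dvd_mul_left (p : ℤ) ((n : ℤ) - j)))

/-- **`φ_0 = (−1)^{n(p−1)B}·Φ_{n,p}(−K)`** at every prime (`φ_0 = N(0)/D(0)`; the tree's `BrickLaurent.phiCoeff_zero` is the
odd-`p` case `φ_0 = Φ_{n,p}(−K)`). -/
theorem phiCoeff_zero_eq_sign (hp : p.Prime) (A B n : ℕ) (K : ℤ) :
    phiCoeff A B p n K 0 = (-1) ^ (n * (p - 1) * B) * brickPhi A B p n (-(K : ℚ)) := by
  have h := brickPhi_neg_add_eq_sign hp A B n K 0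
  rw [add_zero] at h
  rw [phiCoeff, phiSeries, coeff_zero_expandAt, ← aeval_eq_eval_map, ← aeval_eq_eval_map, h, ← mul_assoc, ← pow_add,
    ← two_mul, pow_mul, neg_one_sq, one_pow, one_mul]

end sign

/-! ## The arithmetic of `φ_m` at every prime: integrality with slope `−1`, the unit `φ_0` -/

section arithmetic

variable {p : ℕ} [Fact p.Prime]

/-- A linear factor `a + b·T` with `a ∈ ℤ_(p)`, `b ∈ pℤ_(p)` is `(−1, 0)`-integral: `[T^k] ∈ p^kℤ_(p)`. [folklore] -/
theorem isSlopeInt_coe_C_add_C_mul_X {a b : ℚ} (ha : Rat.padicValuation p a ≤ 1)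
    (hb : Rat.padicValuation p b ≤ exp (-1)) : IsSlopeInt p (-1) 0 ((C a + C b * X : ℚ[X]) : PowerSeries ℚ) := by
  intro k
  match k with
  | 0 =>
    rw [Polynomial.coeff_coe, coeff_add, coeff_C_zero, coeff_C_mul, coeff_X_zero, mul_zero, add_zero]
    simpa using ha
  | 1 =>
    rw [Polynomial.coeff_coe, coeff_add, coeff_C, if_neg one_ne_zero, coeff_C_mul, coeff_X_one, mul_one, zero_add]
    simpa using hb
  | k + 2 =>
    rw [Polynomial.coeff_coe, coeff_add, coeff_C, if_neg (by omega), coeff_C_mul, coeff_X_of_ne_one (by omega),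
      mul_zero, add_zero, map_zero]
    exact zero_le

/-- The same for `a − b·T`. [folklore] -/
theorem isSlopeInt_coe_C_sub_C_mul_X {a b : ℚ} (ha : Rat.padicValuation p a ≤ 1)
    (hb : Rat.padicValuation p b ≤ exp (-1)) : IsSlopeInt p (-1) 0 ((C a - C b * X : ℚ[X]) : PowerSeries ℚ) := by
  have hb' : Rat.padicValuation p (-b) ≤ exp (-1) := by rwa [Valuation.map_neg]
  have h := isSlopeInt_coe_C_add_C_mul_X (p := p) ha hb'
  rwa [C_neg, neg_mul, ← sub_eq_add_neg] at h

/-- Products of `(w, 0)`-integral polynomials are `(w, 0)`-integral (as power series). [folklore] -/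
theorem isSlopeInt_coe_prod {ι : Type*} (s : Finset ι) (f : ι → ℚ[X]) {w : ℤ}
    (h : ∀ i ∈ s, IsSlopeInt p w 0 ((f i : ℚ[X]) : PowerSeries ℚ)) :
    IsSlopeInt p w 0 (((∏ i ∈ s, f i : ℚ[X])) : PowerSeries ℚ) := by
  classical
  induction s using Finset.induction_on with
  | empty => rw [prod_empty, Polynomial.coe_one]; exact isSlopeInt_one w
  | insert a s ha ih =>
    rw [prod_insert ha, Polynomial.coe_mul]
    have := isSlopeInt_mul (h a (mem_insert_self a s)) (ih fun i hi => h i (mem_insert_of_mem hi))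
    rwa [add_zero] at this

/-- Powers of a `(w, 0)`-integral polynomial are `(w, 0)`-integral. [folklore] -/
theorem isSlopeInt_coe_pow (f : ℚ[X]) {w : ℤ} (h : IsSlopeInt p w 0 ((f : ℚ[X]) : PowerSeries ℚ)) (m : ℕ) :
    IsSlopeInt p w 0 (((f ^ m : ℚ[X])) : PowerSeries ℚ) := by
  rw [Polynomial.coe_pow]; simpa using isSlopeInt_pow h m

/-- **`N(T)` is `(−1,0)`-integral**: `[T^k]N ∈ p^kℤ_(p)` (every factor of `N` is `c ± pT`, `c ∈ ℤ`). -/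
theorem isSlopeInt_phiNum (A B n : ℕ) (j : ℤ) :
    IsSlopeInt p (-1) 0 ((((phiNum A B p n j).map (Int.castRingHom ℚ)) : ℚ[X]) : PowerSeries ℚ) := by
  have hpv : Rat.padicValuation p ((p : ℤ) : ℚ) ≤ exp (-1) := by rw [Int.cast_natCast, Rat.padicValuation_self]
  have hint : ∀ z : ℤ, Rat.padicValuation p (z : ℚ) ≤ 1 := fun z => by rw [Rat.padicValuation_cast]; exact Int.padicValuation_le_one p z
  have hC : ∀ z : ℤ, IsSlopeInt p (-1) 0 (((C (z : ℚ) : ℚ[X])) : PowerSeries ℚ) := fun z => by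
    rw [Polynomial.coe_C]; exact isSlopeInt_C (-1) (by rw [exp_zero]; exact hint z)
  rw [phiNum, Polynomial.map_mul, Polynomial.map_mul, Polynomial.map_pow, Polynomial.map_pow, Polynomial.map_pow,
    Polynomial.map_prod, Polynomial.map_prod, Polynomial.map_C, eq_intCast, Polynomial.coe_mul, Polynomial.coe_mul]
  have h1 : IsSlopeInt p (-1) 0 (((C ((((∏ m ∈ (Icc 1 (n * p)).filter (fun m => ¬ p ∣ m), m : ℕ)) : ℤ) : ℚ)
      ^ (A - 2 * B) : ℚ[X])) : PowerSeries ℚ) := isSlopeInt_coe_pow _ (hC _) _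
  have h2 : IsSlopeInt p (-1) 0 (((∏ m ∈ (Icc 1 (n * p)).filter (fun m => ¬ p ∣ m),
      (C (j * p + (m : ℤ)) - C (p : ℤ) * X).map (Int.castRingHom ℚ)) ^ B : ℚ[X]) : PowerSeries ℚ) :=
    isSlopeInt_coe_pow _ (isSlopeInt_coe_prod _ _ fun m _ => by
      rw [Polynomial.map_sub, Polynomial.map_mul, Polynomial.map_C, Polynomial.map_C, map_X, eq_intCast, eq_intCast]
      exact isSlopeInt_coe_C_sub_C_mul_X (hint _) hpv) B
  have h3 : IsSlopeInt p (-1) 0 (((∏ m ∈ (Icc 1 (n * p)).filter (fun m => ¬ p ∣ m),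
      (C (((n : ℤ) - j) * p + (m : ℤ)) + C (p : ℤ) * X).map (Int.castRingHom ℚ)) ^ B : ℚ[X]) : PowerSeries ℚ) :=
    isSlopeInt_coe_pow _ (isSlopeInt_coe_prod _ _ fun m _ => by
      rw [Polynomial.map_add, Polynomial.map_mul, Polynomial.map_C, Polynomial.map_C, map_X, eq_intCast, eq_intCast]
      exact isSlopeInt_coe_C_add_C_mul_X (hint _) hpv) B
  have h := isSlopeInt_mul (isSlopeInt_mul h1 h2) h3
  rwa [add_zero, add_zero] at h

/-- **`D(T)` is `(−1,0)`-integral**: `[T^k]D ∈ p^kℤ_(p)`. -/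
theorem isSlopeInt_phiDen (A n : ℕ) (j : ℤ) :
    IsSlopeInt p (-1) 0 ((((phiDen A p n j).map (Int.castRingHom ℚ)) : ℚ[X]) : PowerSeries ℚ) := by
  have hpv : Rat.padicValuation p ((p : ℤ) : ℚ) ≤ exp (-1) := by rw [Int.cast_natCast, Rat.padicValuation_self]
  have hint : ∀ z : ℤ, Rat.padicValuation p (z : ℚ) ≤ 1 := fun z => by rw [Rat.padicValuation_cast]; exact Int.padicValuation_le_one p z
  rw [phiDen, Polynomial.map_pow, Polynomial.map_prod]
  exact isSlopeInt_coe_pow _ (isSlopeInt_coe_prod _ _ fun m _ => by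
    rw [Polynomial.map_add, Polynomial.map_mul, Polynomial.map_C, Polynomial.map_C, map_X, eq_intCast, eq_intCast]
    exact isSlopeInt_coe_C_add_C_mul_X (hint _) hpv) A

/-- **`Φ_{n,p}(−K+T) ∈ ℤ_(p)⟦T⟧` with slope `−1` at EVERY prime: `φ_m ∈ p^mℤ_(p)`** (`N/D` with `N, D` `(−1,0)`-integral
and `D(0)` a unit).  (For `p ≥ 5` the tree has the finer `Φ(−K+T) = 1 + p³G(T)`, `BrickPhiCoeff.phiSeries_eq_one_add`.) -/
theorem isSlopeInt_phiSeries_neg_one (A B n : ℕ) (K : ℤ) : IsSlopeInt p (-1) 0 (phiSeries A B p n K) := by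
  -- `D(0)` is a `p`-adic unit at every prime (the tree's `BrickPhiCoeff.padicValuation_constantCoeff_phiDen` has `p ≥ 5`)
  have hD0 : Rat.padicValuation p (PowerSeries.constantCoeff
      ((((phiDen A p n K).map (Int.castRingHom ℚ)) : ℚ[X]) : PowerSeries ℚ)) = 1 := by
    rw [Polynomial.constantCoeff_coe, Polynomial.coeff_map, eq_intCast, Rat.padicValuation_cast,
      Int.padicValuation_eq_one_iff]
    exact not_dvd_phiDen_coeff_zero' Fact.out A n K
  have h := isSlopeInt_mul (isSlopeInt_phiNum (p := p) A B n K) (isSlopeInt_inv (isSlopeInt_phiDen (p := p) A n K) hD0)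
  rw [add_zero] at h
  rw [phiSeries, expandAt, taylor_zero, taylor_zero]
  exact h

/-- Coefficientwise: **`v_p(φ_m) ≤ exp(−m)`**, i.e. `p^m ∣ φ_m` in `ℤ_(p)`, every prime, every `A, B, n, K`. -/
theorem padicValuation_phiCoeff_le_exp_neg (A B n : ℕ) (K : ℤ) (m : ℕ) :
    Rat.padicValuation p (phiCoeff A B p n K m) ≤ exp (-(m : ℤ)) := by
  have h := isSlopeInt_phiSeries_neg_one (p := p) A B n K m
  rwa [neg_one_mul, add_zero] at h

/-- In particular `φ_m ∈ ℤ_(p)` (every prime; the tree's `BrickPhiCoeff.isSlopeInt_phiSeries` has `p ≥ 5`). -/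
theorem padicValuation_phiCoeff_le_one (A B n : ℕ) (K : ℤ) (m : ℕ) : Rat.padicValuation p (phiCoeff A B p n K m) ≤ 1 :=
  (padicValuation_phiCoeff_le_exp_neg A B n K m).trans (by rw [← exp_zero, exp_le_exp]; omega)

/-- **`φ_0 = N(0)/D(0)` is a `p`-adic UNIT** — every prime, every `A, B` (both constant terms are prime to `p`). -/
theorem padicValuation_phiCoeff_zero_eq_one (A B n : ℕ) (K : ℤ) :
    Rat.padicValuation p (phiCoeff A B p n K 0) = 1 := by
  have hp : p.Prime := Fact.out
  rw [phiCoeff, phiSeries, coeff_zero_expandAt, ← coeff_zero_eq_eval_zero, ← coeff_zero_eq_eval_zero,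
    Polynomial.coeff_map, Polynomial.coeff_map, eq_intCast, eq_intCast, map_div₀, Rat.padicValuation_cast,
    Rat.padicValuation_cast, Int.padicValuation_eq_one_iff.2 (not_dvd_phiNum_coeff_zero hp A B n K),
    Int.padicValuation_eq_one_iff.2 (not_dvd_phiDen_coeff_zero' hp A n K), div_one]

/-- **`v_p(Φ_{n,p}(−j)) = 0`**, i.e. `Φ_{n,p}(−j)` is a `p`-adic unit — EVERY prime, EVERY `A, B, n`, `j ∈ ℤ`
(the tree's `BrickPhiSymmetry.padicValuation_brickPhi_neg_eq_one` carries `p ≥ 5`, `2B ≤ A` from the `Φ4` route). -/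
theorem padicValuation_brickPhi_neg_eq_one' (A B n : ℕ) (j : ℤ) :
    Rat.padicValuation p (brickPhi A B p n (-(j : ℚ))) = 1 := by
  have hp : p.Prime := Fact.out
  have h : brickPhi A B p n (-(j : ℚ)) = (-1) ^ (n * (p - 1) * B) * phiCoeff A B p n j 0 := by
    rw [phiCoeff_zero_eq_sign hp, ← mul_assoc, ← pow_add, ← two_mul, pow_mul, neg_one_sq, one_pow, one_mul]
  rw [h, map_mul, map_pow, Valuation.map_neg, map_one, one_pow, one_mul, padicValuation_phiCoeff_zero_eq_one]

end arithmetic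

/-! ## Digit-locality at every prime: `v_p(Φ(−j′) − Φ(−j)) ≥ e + 1` when `p^e ∣ j − j′` -/

section locality

variable {p : ℕ} [Fact p.Prime]

/-- `D_j(j − j′) = D_{j′}(0)` is a `p`-adic unit — every prime. -/
theorem padicValuation_phiDen_eval_shift' (A n : ℕ) (j j' : ℤ) :
    Rat.padicValuation p (((phiDen A p n j).map (Int.castRingHom ℚ)).eval ((j : ℚ) - j')) = 1 := by
  rw [← Int.cast_sub, eval_intCast_map, eq_intCast, Int.cast_id, eval_phiDen_shift, Rat.padicValuation_cast,
    Int.padicValuation_eq_one_iff, ← coeff_zero_eq_eval_zero]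
  exact not_dvd_phiDen_coeff_zero' Fact.out A n j'

/-- The Taylor remainder `R_j := N_j − φ_0·D_j ∈ ℚ[T]` has `[T^k]R_j ∈ p^kℤ_(p)` — every prime (both `N_j` and `D_j` do,
and `φ_0 ∈ ℤ_(p)`). -/
theorem padicValuation_coeff_remainder_le' (A B n : ℕ) (j : ℤ) (k : ℕ) :
    Rat.padicValuation p (((phiNum A B p n j).map (Int.castRingHom ℚ) -
      C (phiCoeff A B p n j 0) * (phiDen A p n j).map (Int.castRingHom ℚ)).coeff k) ≤ exp (-(k : ℤ)) := by
  have hN := isSlopeInt_phiNum (p := p) A B n j k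
  have hD := isSlopeInt_phiDen (p := p) A n j k
  rw [Polynomial.coeff_coe, neg_one_mul, add_zero] at hN hD
  rw [coeff_sub, coeff_C_mul]
  refine (Valuation.map_sub _ _ _).trans (max_le hN ?_)
  rw [map_mul]
  calc _ ≤ 1 * exp (-(k : ℤ)) := mul_le_mul' (padicValuation_phiCoeff_le_one A B n j 0) hD
    _ = _ := one_mul _

/-- **`v_p(Φ_{n,p}(−j′) − Φ_{n,p}(−j)) ≤ exp(−(e+1))` whenever `p^e ∣ j − j′`** — EVERY prime, every `A, B, n` (the Taylor
expansion at `−j` evaluated at `T = j − j′`: `Φ(−j′) − Φ(−j) = ±T·(R_j/T)(T)/D_j(T)` with `[T^k](R_j/T) ∈ p^{k+1}ℤ_(p)`).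
The tree's `BrickWeightLocality.padicValuation_brickPhi_sub_le` gives `e + 3` for `p ≥ 5`, `2B ≤ A`. -/
theorem padicValuation_brickPhi_sub_le_succ (A B n : ℕ) {j j' : ℤ} {e : ℕ} (he : (p : ℤ) ^ e ∣ j - j') :
    Rat.padicValuation p (brickPhi A B p n (-(j' : ℚ)) - brickPhi A B p n (-(j : ℚ))) ≤ exp (-((e + 1 : ℕ) : ℤ)) := by
  have hp : p.Prime := Fact.out
  set σ : ℚ := (-1) ^ (n * (p - 1) * B) with hσ
  set P : ℚ[X] := (phiNum A B p n j).map (Int.castRingHom ℚ) with hP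
  set Q : ℚ[X] := (phiDen A p n j).map (Int.castRingHom ℚ) with hQ
  set T₀ : ℚ := (j : ℚ) - j' with hT₀
  set R : ℚ[X] := P - C (phiCoeff A B p n j 0) * Q with hRdef
  have hQT : Rat.padicValuation p (Q.eval T₀) = 1 := padicValuation_phiDen_eval_shift' A n j j'
  have hQT0 : Q.eval T₀ ≠ 0 := fun h => by rw [h, map_zero] at hQT; exact zero_ne_one hQT
  have h1 : brickPhi A B p n (-(j' : ℚ)) = σ * (P.eval T₀ / Q.eval T₀) := by
    rw [show (-(j' : ℚ)) = -(j : ℚ) + T₀ by rw [hT₀]; ring, brickPhi_neg_add_eq_sign hp, aeval_eq_eval_map,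
      aeval_eq_eval_map]
  have h2 : brickPhi A B p n (-(j : ℚ)) = σ * phiCoeff A B p n j 0 := by
    rw [phiCoeff_zero_eq_sign hp, hσ, ← mul_assoc, ← pow_add, ← two_mul, pow_mul, neg_one_sq, one_pow, one_mul]
  have hR0 : R.coeff 0 = 0 := by
    rw [hRdef, coeff_sub, coeff_C_mul, coeff_zero_eq_eval_zero, coeff_zero_eq_eval_zero, phiCoeff, phiSeries,
      coeff_zero_expandAt, ← hP, ← hQ, div_mul_cancel₀ _ (eval_phiDen_zero_ne_zero A p n j), sub_self]
  have hRX : R = X * divX R := by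
    conv_lhs => rw [← X_mul_divX_add R, hR0, map_zero, add_zero]
  have hdiff : brickPhi A B p n (-(j' : ℚ)) - brickPhi A B p n (-(j : ℚ)) =
      σ * (T₀ * (divX R).eval T₀ / Q.eval T₀) := by
    rw [h1, h2, ← mul_sub]
    congr 1
    rw [eq_div_iff hQT0, sub_mul, div_mul_cancel₀ _ hQT0]
    have : R.eval T₀ = T₀ * (divX R).eval T₀ := by conv_lhs => rw [hRX]; rw [eval_mul, eval_X]
    rw [← this, hRdef, eval_sub, eval_mul, eval_C]
  have hσv : Rat.padicValuation p σ = 1 := by rw [hσ, map_pow, Valuation.map_neg, map_one, one_pow]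
  have hT : Rat.padicValuation p T₀ ≤ exp (-(e : ℤ)) := by
    obtain ⟨c, hc⟩ := he
    rw [hT₀, ← Int.cast_sub, hc, Int.cast_mul, Int.cast_pow, Int.cast_natCast, map_mul, map_pow,
      Rat.padicValuation_self, ← exp_nsmul, nsmul_eq_mul, mul_neg_one, Rat.padicValuation_cast]
    calc _ ≤ exp (-(e : ℤ)) * 1 := mul_le_mul' le_rfl (Int.padicValuation_le_one _ _)
      _ = _ := mul_one _
  have hT1 : Rat.padicValuation p T₀ ≤ 1 := hT.trans (by rw [← exp_zero, exp_le_exp]; omega)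
  have hD : Rat.padicValuation p ((divX R).eval T₀) ≤ exp (-1) := by
    rw [eval_eq_sum_range]
    refine Valuation.map_sum_le _ fun k _ => ?_
    rw [map_mul, map_pow, coeff_divX]
    have hk : Rat.padicValuation p (R.coeff (k + 1)) ≤ exp (-1) :=
      (padicValuation_coeff_remainder_le' A B n j (k + 1)).trans (by rw [exp_le_exp]; push_cast; omega)
    calc _ ≤ exp (-1) * 1 ^ k := mul_le_mul' hk (pow_le_pow_left' hT1 k)
      _ = _ := by rw [one_pow, mul_one]
  rw [hdiff, map_mul, hσv, one_mul, map_div₀, hQT, div_one, map_mul]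
  calc _ ≤ exp (-(e : ℤ)) * exp (-1) := mul_le_mul' hT hD
    _ = _ := by rw [← exp_add]; congr 1; push_cast; ring

end locality

end

end Summit.KontsevichZagierPeriods.Zeta5Search.BrickPhiAllPrimes
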